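import Summits.CriticalPhenomena.CardyFormulaZ2.Theses.CardyBoundaryCoulombGas
import Summits.CriticalPhenomena.CardyFormulaZ2.Theorems.RectilinearCardy.Negative.RectilinearCardyReductions
import Summits.CriticalPhenomena.CardyFormulaZ2.Theorems.RectilinearCardy.Negative.RectilinearCardySquareInstance
import Literature.Probability.LatticeModels.CollarLegModel
import Literature.Probability.LatticeModels.DomainDiscretisation
import HarnessLib.Audit

/-!
# Line `quarter-charge-corners` — CHECKED SKELETON for the crux `RectilinearCardy`
(item stmt-CriticalPhenomena-5660, rank-4 crux of route `CardyBoundaryCoulombGas`, sub-problem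
`CardyFormulaZ2`; crux-plan round 1, planner
`planner-cruxplan-stmt-CriticalPhenomena-5660-quarter-charge-corne-0`, 2026-08-16)

The crux (typed, route file rev 10): Cardy's formula for critical bond percolation on `ℤ²` in
every conformal rectangle whose Jordan boundary lies in finitely many axis-parallel segments,
`∀ R, IsRectilinear R → R.HasCrossingLimit (bondDomainCrossingProb R) cardyFunction`. The
composition `RectilinearCardy_of` concludes THAT constant by name from seven registered stubs;
`rectilinearCardy_of_routeLegLaw` concludes it from the route's engine crux
`BoundaryDefectGaussianR` (stmt-14132, registered item) and stubs 4–7.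

## Idea (card `Ideas/quarter-charge-corners.md`, ideator 1; triage r1-1/2/3: pass ×3)

On a rectilinear polygon the background charge of the route's boundary Coulomb gas is not smeared
along the rim but sits at the corners as quantized charges `-τ_j/2π = ∓1/4`, by the EXACT
Schwarz–Christoffel identity `|w'(x)|^{-e/6} = c ∏_j |w(x) - w_j|^{e q_j/3}`; the unit marks of the
mark-density member `(1,1,1;3̄)` are TILT-BLIND (`h(1) = 0`), so the polygon mark density is the
half-plane pure product read in harmonic-measure coordinates, `m_Ω ds = m_ℍ(w) dw`, i.e. exactly
what the route's `PureProductIntegrates` consumes; and the ENGINE splits into a tilt-free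
Gaussian statement for a POSITIVE model plus a "corner potential" `V = (1/6) log ω'`. Triage
sharpenings made load-bearing here: (r1-2, mandatory) the split is re-cut as NAIVE (positive
six-vertex model, `J`-bookkeeping, no background charge) × TWIST ANOMALY (one-body `-L_i/6` AND
source–sink pairs `+L_i/3`), cf. card `twist-anomaly-factorisation` of stmt-14132; (r1-3 of
stmt-14132) the unrenormalised naive factor is FALSE for odd data (a wired arc of the positive
model carries a tension `τ^{ℓ/δ}`) — the naive factor below is RENORMALISED by the two one-leg
data `(1;1̄)` on the two wired stretches `[a,b]`, `[c,x]` of the `(1,1,1;3̄)` collar, which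
cancels tensions and wired-corner factors in form and leaves clean Dirichlet electrostatics
(`naiveRHS`: jumps `(1,1,1,-3) - (1,-1)_{ab} - (1,-1)_{cx}`); (r1-3) the renormalisation `c_δ`
of the corner potential is the explicit mesh factor `δ^{1/3}` of `anomalySeq`; (r1-1/2) the
density law is LOCAL, strictly stronger than the crux; its integration (with the constant pinned
by total mass, not asserted) and the RSW tightness at corners/marks are separate stubs.

## What is typed (all over existing declarations; local `def`s are abbreviations, not assumptions)

* ENGINE SIDE (§1): the `(1,1,1;3̄)` member only (the crux needs nothing else). `LegPrefix` is
  VERBATIM the quantifier prefix of the route decl `BoundaryDefectGaussianR` at `k = 4`,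
  `L = (1,1,1,3)`, `j = 3` (charts `w : Ω → ℍ` holomorphic across the flat sides near the marks,
  closure lattice polygons `V_n = Ω̄ ∩ δ_n ℤ²`, injective admissible realisations); certified by
  `legLaw1113_of_route : BoundaryDefectGaussianR → LegLaw1113` (application + `kacConcl_of_raw`,
  sorry-free). `Zpos M = Σ_h ‖weight h‖` is the positive six-vertex partition function of a collar
  model (phases dropped). `PolygonNaive1113` / `PolygonAnomaly1113` / `LegLaw1113` share the prefix
  and the two extra one-leg admissibilities (`WithAdm11`); `rhs_split` (sorry-free) certifies
  naive value × anomaly value = Kac value. Junk analysis: `x/0 = 0` and `0^y` (`y ≠ 0`) `= 0` make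
  every displayed identity total EXCEPT the lattice identity `kacSeq = naiveSeq · anomalySeq`,
  which needs the four `Z⁺ ≠ 0` — part of `stub_split` (eventual non-vanishing from the naive
  limit, or `Z⁺ > 0` for admissible data). Orientation: for a clockwise-parametrised domain the
  chart clause is unsatisfiable (vacuous member), exactly as in the route decl.
* PERCOLATION SIDE (§2): closure lattice polygons `latt`, boundary rows `bRow`, lattice SHADOWS
  `bArc D δ B` (boundary-row sites at distance `< δ` from `B`; along a flat side the shadow of a
  growing sub-arc gains vertices one at a time, in order), `crossProb`, the monotone family
  `hitProb D δ t = P[(ab)-shadow ↔ shadow of [c, boundary t]]` (`hitProb_mono`,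
  `openCrossing_insert`: its one-vertex increments are the mark events), `PolygonMarkDensity`
  (local law, `∃ C` universal, constant NOT asserted to be `cardyConst/3`), `PolygonTightness`
  ((T-small): one-arm smallness around any point off the closed arc `(ab)`; (T-one): near-sure
  hitting once the remaining gap arc back to `a` is spatially small — NOT mere closeness of the
  tip, which thin necks defeat), `ClosureCardy`, `DiscretisationInsensitive` (the crux's
  `meshDomain`/`discreteArc` discretisation vs the closure one). `hitProb_drop4` (sorry-free):
  at the fourth mark the density family telescopes EXACTLY to `closureCrossingProb R δ`;
  `hasCrossingLimit_of_closure` (sorry-free): closure Cardy + insensitivity ⇒ the crux's limit.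

## Stubs (7) — sizes, and what each must do

1. `stub_naive` (XL) — `PolygonNaive1113`: boundary DKLM for the POSITIVE `Δ = -1/2` six-vertex
   model with jump/wired collar data in rectilinear polygons, in the renormalised form `N♮`
   (tensions cancelled): `δ^{-4/3} N♮ → C |ab|^{2/3}|ac|^{1/3}|bc|^{1/3}|ax|^{-1}|bx|^{-1}|cx|^{-2/3}|w'(x)|^{4/3}`.
   Positive associated measure: FKG, reflection positivity through face lines, RSW uniform in
   boundary conditions (DKLM 2026 Thm 26, Cor 81, Part D), full-plane input `σ² = 3/π`
   (`DKLM2026_sixVertex_heightFunction_GFF`, unproved named fact); template Kenyon's Dirichlet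
   GFF theorem in polygons. Numerics: kit j009016 (stmt-14132) — positive strip realises the
   naive column (slope → 3/2π, ratio 4).
2. `stub_anomaly` (XL, HARDEST) — `PolygonAnomaly1113`: the twist anomaly `A♮ = full/N♮`,
   `δ^{1/3} A♮ → C |ab|^{-1/3}|ax|^{1/3}|bx|^{1/3}|w'(x)|^{-1/3}`: complex collar phases (no
   positivity), carries the sink rule AND the corner potential; handles: transfer-matrix Perron
   form on strips, cumulant expansion of the wall twist, DKLM Thm 14-type factorisation.
   Numerics: route j005323 (Kac column incl. linear term), ideator j008112/j008116 (convex-corner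
   factor `ω'^{1/3}`, widths ≤ 12); reflex corner `s^{-1/9}` untested = cheapest falsifier.
3. `stub_split` (M) — `PolygonNaive1113 → PolygonAnomaly1113 → LegLaw1113`: product of limits,
   `rhs_split`, eventual non-vanishing of the four `Z⁺`.
4. `stub_markDensity` (M/L) — `LegLaw1113 → PolygonMarkDensity`: the BKW RAINBOW DICTIONARY
   `‖Zins‖/‖Z‖ = P[{v ↔ [a,b]} ∖ {[c,x] ↔ [a,b]}]` (SPEC §D4 of stmt-14132, enumeration-verified,
   to be proved), admissible realisations of the three data along boundary rows, re-marking
   `(Ω; a,b,c)` with the moving point as a `MarkedDomain 4`, `V_n ↔ latt`, `openCrossing_insert`.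
5. `stub_tightness` (M/L) — `PolygonTightness`: RSW/duality in polygons with corners
   (`rsw_half_holds`, `harris_fkg_holds`, `discreteCrossingProb_clusterPt_mem_Ioo_holds` technology).
6. `stub_integration` (L) — `PolygonMarkDensity → PolygonTightness → ClosureCardy`: Schwarz-
   reflection charts for polygons (prover's choice: `∞` inside arc `(bc)`), local law ⇒ uniform
   on compact flat pieces (contradiction/subsequence), Riemann sums of one-vertex increments,
   corner and initial pieces by (T-small), constant pinned to `cardyConst/3` by (T-one) + total
   mass (`PureProductIntegrates`, Disproof §9 of stmt-14132 `constant_le_of_markDensityShapeWith`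
   is the `≤` half), corner marks by approximation + (T-small), `crossRatio x` = cross-ratio of
   the chart images (Möbius invariance), sequences ⇒ `𝓝[>] 0`.
7. `stub_discretisation` (M/L) — `DiscretisationInsensitive`: interior vs closure lattice points
   (sides on lattice lines), nearest-arc discrete arcs vs `< δ` shadows, largest component;
   one-row boundary layer (the obstruction recorded at Disproof `squareCrossingHalf_conj`).

## Disproof.lean (cdisprove cycles 1–2, 2026-08-16) and landed Negative lemmas — obligations honoured

No `_false_without_` theorem exists for this crux (verdict, cycles 1–2: "no kill; the crux
resists for a structural reason"). Cycle 2 (read again at the publishing boundary): §7 is a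
PRE-EMPTIVE targets round on the round-1 cards' first lemmas — this card's
`QuadrantMarkDensityLaw` re-read and found clean (only `RankOneWardBox` of another card is false
at the constant level); §9 (lattice polygons of any mesh are rectilinear; more hostages
stmt-4781/4782/4783/5843) and §10 (only the law's values on `(0,1)` matter) touch no stub here
(all statements below quantify over ALL rectilinear domains and assert `cardyFunction` only
through `HasCrossingLimit`). Used POSITIVELY: §1 (crux = conjunct restricted to rectilinear
polygons: nothing here weakens or restates it; `isRectilinearJ_iff`); §2 "one datum suffices"
(the composition proves `HasCrossingLimit` for every datum directly, `hasCrossingLimit_of_closure`);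
§3 no-junk (`ClosureCardy`/`PolygonTightness` make no degenerate-arc claim; (T-one) is stated so
that thin necks do not falsify it); §4 symmetric instances (every statement here is reflection-
symmetric); §5 "rectilinearity is load-bearing only for the ENGINE" — exactly: it enters through
the closed BKW collar of `V_n = Ω̄ ∩ δℤ²` in stubs 1–4 and nowhere in 5–7; §6 rectangles realise
every modulus (so stubs 1–4 on RECTANGLES + 5–7 already pin the scaling law); §8 near-miss
`squareCrossingHalf_conj` = the boundary-layer estimate isolated as `stub_discretisation`. Both
landed Negative files (`RectilinearCardyReductions`, `RectilinearCardySquareInstance`) are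
IMPORTED: nothing they prove refutes a stub (they are reductions/instances). Negatives index
(CardyFormulaZ2: stmt-0748 degenerate arcs, stmt-6949 dual-current template, stmt-8581 `≤`-tie
sure crossing): shadows use `< δ` and disjoint closed arcs at positive distance, no parafermionic
template; nothing restated. Settled negatives of the route: stmt-6952 (electric dictionary) not
used — the dictionary of `stub_markDensity` is the LEG reading; stmt-6947 (pair exponent `4A`,
naive sink) is exactly what `naiveRHS` assigns to the WRONG (positive) model, corrected by
`anomalyRHS` (`rhs_split`).
-/

noncomputable section

open Filter Topology Set MeasureTheory
open scoped BigOperators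

namespace Summit.CriticalPhenomena.CardyFormulaZ2.Cruxes.RectilinearCardy.QuarterChargeCorners

open Literature.Probability.LatticeModels (Site zdGraph meshPoint CollarLegModel)
open Literature.Probability.LatticeModels.CollarLegModel (LegInsertionData Zins ofDomain)
open Literature.Probability.Percolation (bondPercolation half openCrossing bondDomainCrossingProb)
open Literature.Probability.RandomPlanarGeometry (JordanDomain MarkedDomain ConformalRectangle
  cardyFunction crossRatio)
open Summit.CriticalPhenomena.CardyFormulaZ2.Theses.CardyBoundaryCoulombGas (RectilinearCardy
  BoundaryDefectGaussianR)

/-! ### §1 Engine side: the `(1,1,1;3̄)` member, its positive-model factor and its twist anomaly -/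

/-- Leg numbers of the mark-density family `(1,1,1;3̄)`: unit sources `a, b, c`, a 3-leg sink `x`. [folklore] -/
def L1113 : Fin 4 → ℕ := ![1, 1, 1, 3]

/-- The `(1,1,1;3̄)` leg datum at lattice points `q 0, q 1, q 2` (sources) and `q 3` (sink) —
LITERALLY the constructor of the route decl `BoundaryDefectGaussianR` at `k = 4`, `L = L1113`,
`j = 3` (so that the route item specialises to `LegLaw1113` by application,
`legLaw1113_of_route`). [folklore] -/
def legs1113 (q : Fin 4 → ℤ × ℤ) : LegInsertionData :=
  ⟨(Finset.univ.erase 3).image q,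
    fun v ↦ ∑ i ∈ (Finset.univ.erase 3).filter (fun i ↦ q i = v), L1113 i, q 3⟩

/-- The one-leg datum `(1;1̄)` from the source `s` to the sink `t`: its jump collar is ONE wired
arc from `s` to `t` (counter-clockwise) and nothing else; `‖Zins‖ = ‖Z‖` exactly in the BKW model
(a wired arc is invisible to `q = 1` percolation), but NOT in the positive model, where a wired
arc carries a boundary tension — this datum is the renormaliser of the naive factor below. [folklore] -/
def legs11 (s t : ℤ × ℤ) : LegInsertionData :=
  ⟨{s}, fun _ ↦ 1, t⟩

/-- The Kac labels of the family: `e_i = L_i` at the sources, `e = 1 - L = -2` at the sink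
(the route's "sink rule" = background charge), in the raw form of the route decl. [folklore] -/
def e1113 (i : Fin 4) : ℝ := if i = 3 then (1 - (L1113 3 : ℝ)) else (L1113 i : ℝ)

/-- **The positive (phase-free) partition function** of a collar model: `Z⁺ = ∑_h ∏ |weights|`.
Every weight is a product of live weights `∈ {1, √3}` and unit-modulus collar phases, so
`‖weight h‖ = √3^{#c-type live edges}`: `Z⁺` IS the partition function of the POSITIVE six-vertex
model `a = b = 1, c = √3` (`Δ = -1/2`) on the same cells with the same prescribed collar / wired /
jump heights (the reference measure `P⁺` of card `twist-anomaly-factorisation` of crux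
stmt-14132, there realised as the tree's `sixVertexHeightModel 1 1 √3`). [folklore] -/
def Zpos (M : CollarLegModel) : ℝ := ∑ h ∈ M.configs, ‖M.weight h‖

/-- The common quantifier prefix of the three engine statements: VERBATIM the prefix of the route
decl `BoundaryDefectGaussianR` (stmt-14132) at `k = 4`, `L = (1,1,1,3)`, `j = 3` — one constant
`C > 0` for all bounded rectilinear Jordan domains with four marks at flat (non-corner) boundary
points, every holomorphic chart `w : Ω → ℍ` extending across the sides near the marks with
`Re (w ∘ boundary)` increasing there, every mesh sequence `δ_n → 0⁺`, the closure lattice polygons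
`V_n = Ω̄ ∩ δ_n ℤ²`, and every injective admissible lattice realisation `p_n → (a, b, c, x)` of the
`(1,1,1;3̄)` datum — applied to a conclusion `concl C D w δ V p`. [folklore] -/
def LegPrefix (concl : ℝ → MarkedDomain 4 → (ℂ → ℂ) → (ℕ → ℝ) → (ℕ → Finset (ℤ × ℤ)) →
    (ℕ → Fin 4 → ℤ × ℤ) → Prop) : Prop :=
  ∃ C : ℝ, 0 < C ∧ ∀ (D : MarkedDomain 4),
    (∃ S : Finset (ℂ × ℂ), (∀ p ∈ S, p.1.re = p.2.re ∨ p.1.im = p.2.im) ∧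
      frontier D.carrier ⊆ ⋃ p ∈ S, segment ℝ p.1 p.2) →
    (∀ i, ∃ r : ℝ, 0 < r ∧ ((∀ z ∈ frontier D.carrier, dist z (D.pt i) < r → z.im = (D.pt i).im) ∨
      (∀ z ∈ frontier D.carrier, dist z (D.pt i) < r → z.re = (D.pt i).re))) →
    ∀ (w : ℂ → ℂ) (U : Set ℂ), IsOpen U → D.carrier ⊆ U → (∀ i, D.pt i ∈ U) →
      DifferentiableOn ℂ w U → Set.BijOn w D.carrier {z : ℂ | 0 < z.im} →
      (∀ i, ∃ ε : ℝ, 0 < ε ∧ StrictMonoOn (fun t : ℝ ↦ (w (D.boundary t)).re)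
        (Set.Ioo (D.mark i - ε) (D.mark i + ε))) →
    ∀ (δ : ℕ → ℝ), (∀ n, 0 < δ n) → Filter.Tendsto δ Filter.atTop (nhds 0) →
    ∀ (V : ℕ → Finset (ℤ × ℤ)),
      (∀ n, ∀ v : ℤ × ℤ, v ∈ V n ↔
        ((v.1 : ℂ) * δ n + (v.2 : ℂ) * δ n * Complex.I) ∈ closure D.carrier) →
    ∀ (p : ℕ → Fin 4 → ℤ × ℤ), (∀ n, Function.Injective (p n)) →
      (∀ i, Filter.Tendsto (fun n ↦ ((p n i).1 : ℂ) * δ n + ((p n i).2 : ℂ) * δ n * Complex.I)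
        Filter.atTop (nhds (D.pt i))) →
      (∀ n, (legs1113 (p n)).IsAdmissible (V n)) →
    concl C D w δ V p

/-- Adds admissibility of the two renormalising one-leg data `(1;1̄)` on `[a,b]` and on `[c,x]`
(the two WIRED stretches of the `(1,1,1;3̄)` collar) as hypotheses of a conclusion. [folklore] -/
def WithAdm11 (concl : ℝ → MarkedDomain 4 → (ℂ → ℂ) → (ℕ → ℝ) → (ℕ → Finset (ℤ × ℤ)) →
    (ℕ → Fin 4 → ℤ × ℤ) → Prop) :
    ℝ → MarkedDomain 4 → (ℂ → ℂ) → (ℕ → ℝ) → (ℕ → Finset (ℤ × ℤ)) → (ℕ → Fin 4 → ℤ × ℤ) → Prop :=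
  fun C D w δ V p ↦ (∀ n, (legs11 (p n 0) (p n 1)).IsAdmissible (V n)) →
    (∀ n, (legs11 (p n 2) (p n 3)).IsAdmissible (V n)) → concl C D w δ V p

/-- The route decl's conclusion at `k = 4`, raw (ifs and `Fin 4` products unexpanded). [folklore] -/
def kacConclRaw (C : ℝ) (D : MarkedDomain 4) (w : ℂ → ℂ) (δ : ℕ → ℝ) (V : ℕ → Finset (ℤ × ℤ))
    (p : ℕ → Fin 4 → ℤ × ℤ) : Prop :=
  Filter.Tendsto (fun n ↦ (δ n) ^ (-(∑ i : Fin 4, e1113 i * (e1113 i - 1) / 6)) *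
      ‖Zins (V n) (legs1113 (p n))‖ / ‖(ofDomain (V n)).Z‖) Filter.atTop
    (nhds (C * (∏ i : Fin 4, ∏ i' ∈ Finset.univ.filter (fun i' : Fin 4 ↦ i < i'),
      ‖w (D.pt i) - w (D.pt i')‖ ^ (e1113 i * e1113 i' / 3)) *
      ∏ i : Fin 4, ‖deriv w (D.pt i)‖ ^ (e1113 i * (e1113 i - 1) / 6)))

/-- `δ_n^{-1} · ‖Z[(1,1,1;3̄)]‖ / ‖Z‖` — the lattice side of the mark-density member (by the BKW
dictionary `= δ_n^{-1} · P[mark event]`, see `stub_markDensity`). [folklore] -/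
def kacSeq (δ : ℕ → ℝ) (V : ℕ → Finset (ℤ × ℤ)) (p : ℕ → Fin 4 → ℤ × ℤ) (n : ℕ) : ℝ :=
  (δ n) ^ (-(1 : ℝ)) * ‖Zins (V n) (legs1113 (p n))‖ / ‖(ofDomain (V n)).Z‖

/-- `C · Δ_w^{1/3} · ∏_{i<3} |w(x) - w(pt i)|^{-2/3} · |w'(x)|` — the Kac value of the member:
pair exponents `e_i e_j / 3` with `e = (1,1,1,-2)`, self exponents `h(1) = 0` (TILT-BLIND MARKS)
and `h(-2) = 1` (the moving mark carries `|w'|¹ = ω'`, harmonic-measure coordinates). [folklore] -/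
def kacRHS (C : ℝ) (D : MarkedDomain 4) (w : ℂ → ℂ) : ℝ :=
  C * (‖w (D.pt 0) - w (D.pt 1)‖ ^ (1 / 3 : ℝ) * ‖w (D.pt 0) - w (D.pt 2)‖ ^ (1 / 3 : ℝ) *
    ‖w (D.pt 1) - w (D.pt 2)‖ ^ (1 / 3 : ℝ) * ‖w (D.pt 0) - w (D.pt 3)‖ ^ (-(2 / 3) : ℝ) *
    ‖w (D.pt 1) - w (D.pt 3)‖ ^ (-(2 / 3) : ℝ) * ‖w (D.pt 2) - w (D.pt 3)‖ ^ (-(2 / 3) : ℝ)) *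
    ‖deriv w (D.pt 3)‖

/-- The clean conclusion of the `(1,1,1;3̄)` Kac law. [folklore] -/
def kacConcl (C : ℝ) (D : MarkedDomain 4) (w : ℂ → ℂ) (δ : ℕ → ℝ) (V : ℕ → Finset (ℤ × ℤ))
    (p : ℕ → Fin 4 → ℤ × ℤ) : Prop :=
  Filter.Tendsto (kacSeq δ V p) Filter.atTop (nhds (kacRHS C D w))

/-- The RENORMALISED NAIVE sequence
`N♮_n = δ_n^{-4/3} · Z⁺[(1,1,1;3̄)] · Z⁺[closed] / (Z⁺[(1;1̄)_{ab}] · Z⁺[(1;1̄)_{cx}])`: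
positive-model partition functions only; the two one-leg factors cancel the wired-arc tension
`τ^{ℓ_wired/δ}` (and the wired-corner factors) of the positive model along the two wired stretches
`[a,b]`, `[c,x]` of the `(1,1,1;3̄)` collar (triage r1-3 of stmt-14132: the unrenormalised naive
factor is FALSE for odd data). [folklore] -/
def naiveSeq (δ : ℕ → ℝ) (V : ℕ → Finset (ℤ × ℤ)) (p : ℕ → Fin 4 → ℤ × ℤ) (n : ℕ) : ℝ :=
  (δ n) ^ (-(4 / 3 : ℝ)) *
    (Zpos ((legs1113 (p n)).model (V n)) * Zpos (ofDomain (V n))) /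
    (Zpos ((legs11 (p n 0) (p n 1)).model (V n)) * Zpos ((legs11 (p n 2) (p n 3)).model (V n)))

/-- The Dirichlet-electrostatics value of `N♮`: jumps `J = (1,1,1,-3)` minus `(1,-1)` at `(a,b)`
minus `(1,-1)` at `(c,x)`, pair exponents `J_i J_j / 3`, self exponents `J_i²/6` (no background
charge): `|ab|^{2/3} |ac|^{1/3} |bc|^{1/3} |ax|^{-1} |bx|^{-1} |cx|^{-2/3} |w'(x)|^{4/3}`. [folklore] -/
def naiveRHS (C : ℝ) (D : MarkedDomain 4) (w : ℂ → ℂ) : ℝ :=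
  C * (‖w (D.pt 0) - w (D.pt 1)‖ ^ (2 / 3 : ℝ) * ‖w (D.pt 0) - w (D.pt 2)‖ ^ (1 / 3 : ℝ) *
    ‖w (D.pt 1) - w (D.pt 2)‖ ^ (1 / 3 : ℝ) * ‖w (D.pt 0) - w (D.pt 3)‖ ^ (-(1 : ℝ)) *
    ‖w (D.pt 1) - w (D.pt 3)‖ ^ (-(1 : ℝ)) * ‖w (D.pt 2) - w (D.pt 3)‖ ^ (-(2 / 3) : ℝ)) *
    ‖deriv w (D.pt 3)‖ ^ (4 / 3 : ℝ)

/-- Conclusion of the renormalised naive law. [folklore] -/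
def naiveConcl (C : ℝ) (D : MarkedDomain 4) (w : ℂ → ℂ) (δ : ℕ → ℝ) (V : ℕ → Finset (ℤ × ℤ))
    (p : ℕ → Fin 4 → ℤ × ℤ) : Prop :=
  Filter.Tendsto (naiveSeq δ V p) Filter.atTop (nhds (naiveRHS C D w))

/-- The TWIST-ANOMALY sequence `A♮_n = (full) / (N♮)`:
`δ_n^{1/3} · ‖Z[(1,1,1;3̄)]‖ · Z⁺[(1;1̄)_{ab}] · Z⁺[(1;1̄)_{cx}] / (‖Z[closed]‖ · Z⁺[(1,1,1;3̄)] · Z⁺[closed])`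
— the ratio (phase-weighted / positive) of the member, renormalised by the two one-leg factors;
this is where ALL of the background charge (sink rule) and ALL of the corner potential of the
idea live. [folklore] -/
def anomalySeq (δ : ℕ → ℝ) (V : ℕ → Finset (ℤ × ℤ)) (p : ℕ → Fin 4 → ℤ × ℤ) (n : ℕ) : ℝ :=
  (δ n) ^ (1 / 3 : ℝ) *
    (‖Zins (V n) (legs1113 (p n))‖ * Zpos ((legs11 (p n 0) (p n 1)).model (V n)) *
      Zpos ((legs11 (p n 2) (p n 3)).model (V n))) /
    (‖(ofDomain (V n)).Z‖ * Zpos ((legs1113 (p n)).model (V n)) * Zpos (ofDomain (V n)))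

/-- The value of the twist anomaly: `|ab|^{-1/3} |ax|^{1/3} |bx|^{1/3} |w'(x)|^{-1/3}` — one-body
part `|w'(x)|^{-1/3} = exp(-2 V(x))`, `V = (1/6) log ω'` the CORNER POTENTIAL (Neumann potential of
the quantized corner charges `-τ_j / 2π`), pair part source–sink only. [folklore] -/
def anomalyRHS (C : ℝ) (D : MarkedDomain 4) (w : ℂ → ℂ) : ℝ :=
  C * (‖w (D.pt 0) - w (D.pt 1)‖ ^ (-(1 / 3) : ℝ) * ‖w (D.pt 0) - w (D.pt 3)‖ ^ (1 / 3 : ℝ) *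
    ‖w (D.pt 1) - w (D.pt 3)‖ ^ (1 / 3 : ℝ)) * ‖deriv w (D.pt 3)‖ ^ (-(1 / 3) : ℝ)

/-- Conclusion of the twist-anomaly law. [folklore] -/
def anomalyConcl (C : ℝ) (D : MarkedDomain 4) (w : ℂ → ℂ) (δ : ℕ → ℝ) (V : ℕ → Finset (ℤ × ℤ))
    (p : ℕ → Fin 4 → ℤ × ℤ) : Prop :=
  Filter.Tendsto (anomalySeq δ V p) Filter.atTop (nhds (anomalyRHS C D w))

/-- **The `(1,1,1;3̄)` member of the route's leg law** (`BoundaryDefectGaussianR`, stmt-14132,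
specialised; `legLaw1113_of_route`), with the two one-leg admissibilities as extra (harmless)
hypotheses so that the three engine statements share one prefix. [folklore] -/
def LegLaw1113 : Prop := LegPrefix (WithAdm11 kacConcl)

/-- STUB 1 statement — **renormalised naive Dirichlet law for the positive six-vertex model in
rectilinear polygons** (the tilt-free half of the idea's engine split). [folklore] -/
def PolygonNaive1113 : Prop := LegPrefix (WithAdm11 naiveConcl)

/-- STUB 2 statement — **the twist anomaly in rectilinear polygons** (the corner-potential half of
the idea's engine split; HARDEST). [folklore] -/
def PolygonAnomaly1113 : Prop := LegPrefix (WithAdm11 anomalyConcl)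

/-! #### Sorry-free certificates of the engine bookkeeping -/

/-- Neutrality of the datum in the route decl's form (`L j = Σ_{i ≠ j} L i`). [folklore] -/
theorem neutral1113 : L1113 3 = ∑ i ∈ Finset.univ.erase 3, L1113 i := by decide

/-- The Kac labels are `(1, 1, 1, -2)`. [folklore] -/
theorem e1113_vals : e1113 0 = 1 ∧ e1113 1 = 1 ∧ e1113 2 = 1 ∧ e1113 3 = -2 := by
  simp [e1113, L1113]
  norm_num

/-- The raw `k = 4` instance of the route decl IS the clean `(1,1,1;3̄)` law: mesh exponent
`-Σ h(e_i) = -1`, pairs `Δ^{1/3} ∏ |x - ·|^{-2/3}`, self factors `|w'(pt i)|⁰ = 1` at the unit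
marks (TILT-BLIND) and `|w'(x)|¹` at the sink. [folklore] -/
theorem kacConcl_of_raw {C : ℝ} {D : MarkedDomain 4} {w : ℂ → ℂ} {δ : ℕ → ℝ}
    {V : ℕ → Finset (ℤ × ℤ)} {p : ℕ → Fin 4 → ℤ × ℤ} (h : kacConclRaw C D w δ V p) :
    kacConcl C D w δ V p := by
  obtain ⟨h0, h1, h2, h3⟩ := e1113_vals
  unfold kacConclRaw at h
  unfold kacConcl kacSeq kacRHS
  simp only [Fin.sum_univ_four, Fin.prod_univ_four, Finset.prod_filter, h0, h1, h2, h3] at h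
  convert h using 2
  · norm_num
  · simp
    norm_num
    ring_nf
    try simp

/-- **The route's engine crux specialises to `LegLaw1113`** (sorry-free): `BoundaryDefectGaussianR`
at `k = 4`, `L = (1,1,1,3)`, `j = 3` is `LegPrefix kacConclRaw` by `rfl`, and `kacConcl_of_raw`
cleans the conclusion. Hence any proof of stmt-14132 feeds this line at `stub_markDensity`
(second composition `rectilinearCardy_of_routeLegLaw`). [folklore] -/
theorem legLaw1113_of_route (h : BoundaryDefectGaussianR) : LegLaw1113 := by
  obtain ⟨C, hC, H⟩ : LegPrefix kacConclRaw := h 4 L1113 3 neutral1113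
  refine ⟨C, hC, fun D hrect hflat w U hU hsub hpt hdiff hbij hmono δ hδ hδ0 V hV p hinj hconv
    hadm _ _ ↦ ?_⟩
  exact kacConcl_of_raw (H D hrect hflat w U hU hsub hpt hdiff hbij hmono δ hδ hδ0 V hV p hinj hconv hadm)

/-- **Exponent bookkeeping of the split** (sorry-free): naive value × anomaly value = Kac value
with the product constant — `2/3 - 1/3 = 1/3` on `ab`, `-1 + 1/3 = -2/3` on `ax`, `bx`,
`4/3 - 1/3 = 1` on `|w'(x)|`; `ac`, `bc`, `cx` are anomaly-free. (Each table is separately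
Möbius-consistent: per point, half the sum of its pair exponents plus its self exponent vanishes.) [folklore] -/
theorem rhs_split (C₁ C₂ : ℝ) (D : MarkedDomain 4) (w : ℂ → ℂ) :
    naiveRHS C₁ D w * anomalyRHS C₂ D w = kacRHS (C₁ * C₂) D w := by
  have key : ∀ x : ℝ, 0 ≤ x → ∀ y z : ℝ, y + z ≠ 0 → x ^ y * x ^ z = x ^ (y + z) :=
    fun x hx y z hyz ↦ (Real.rpow_add' hx hyz).symm
  set A := ‖w (D.pt 0) - w (D.pt 1)‖ with hA
  set B := ‖w (D.pt 0) - w (D.pt 2)‖ with hB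
  set E := ‖w (D.pt 1) - w (D.pt 2)‖ with hE
  set X := ‖w (D.pt 0) - w (D.pt 3)‖ with hX
  set Y := ‖w (D.pt 1) - w (D.pt 3)‖ with hY
  set Zc := ‖w (D.pt 2) - w (D.pt 3)‖ with hZc
  set Wd := ‖deriv w (D.pt 3)‖ with hWd
  have e1 : A ^ (2 / 3 : ℝ) * A ^ (-(1 / 3) : ℝ) = A ^ (1 / 3 : ℝ) := by
    rw [key A (norm_nonneg _) _ _ (by norm_num)]; norm_num
  have e2 : X ^ (-(1 : ℝ)) * X ^ (1 / 3 : ℝ) = X ^ (-(2 / 3) : ℝ) := by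
    rw [key X (norm_nonneg _) _ _ (by norm_num)]; norm_num
  have e3 : Y ^ (-(1 : ℝ)) * Y ^ (1 / 3 : ℝ) = Y ^ (-(2 / 3) : ℝ) := by
    rw [key Y (norm_nonneg _) _ _ (by norm_num)]; norm_num
  have e4 : Wd ^ (4 / 3 : ℝ) * Wd ^ (-(1 / 3) : ℝ) = Wd := by
    rw [key Wd (norm_nonneg _) _ _ (by norm_num)]; norm_num
  have hprod : naiveRHS C₁ D w * anomalyRHS C₂ D w =
      C₁ * C₂ * ((A ^ (2 / 3 : ℝ) * A ^ (-(1 / 3) : ℝ)) * B ^ (1 / 3 : ℝ) * E ^ (1 / 3 : ℝ) *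
        (X ^ (-(1 : ℝ)) * X ^ (1 / 3 : ℝ)) * (Y ^ (-(1 : ℝ)) * Y ^ (1 / 3 : ℝ)) *
        Zc ^ (-(2 / 3) : ℝ)) * (Wd ^ (4 / 3 : ℝ) * Wd ^ (-(1 / 3) : ℝ)) := by
    simp only [naiveRHS, anomalyRHS, ← hA, ← hB, ← hE, ← hX, ← hY, ← hZc, ← hWd]
    ring
  rw [hprod, e1, e2, e3, e4]
  simp only [kacRHS, ← hA, ← hB, ← hE, ← hX, ← hY, ← hZc, ← hWd]

/-! ### §2 Percolation side: closure lattice polygons, boundary shadows, the mark density -/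

/-- The frontier of the Jordan domain lies in finitely many axis-parallel segments (the hypothesis
of `RectilinearCardy`, verbatim; `isRectilinearJ_iff`). [folklore] -/
def IsRectilinearJ (D : JordanDomain) : Prop :=
  ∃ S : Finset (ℂ × ℂ), (∀ p ∈ S, p.1.re = p.2.re ∨ p.1.im = p.2.im) ∧
    frontier D.carrier ⊆ ⋃ p ∈ S, segment ℝ p.1 p.2

/-- `∂Ω` is a horizontal or a vertical segment near `z` (`z` is a non-corner boundary point; the
flatness clause of the route decl, verbatim). [folklore] -/
def FlatNear (D : JordanDomain) (z : ℂ) : Prop :=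
  ∃ r : ℝ, 0 < r ∧ ((∀ z' ∈ frontier D.carrier, dist z' z < r → z'.im = z.im) ∨
    (∀ z' ∈ frontier D.carrier, dist z' z < r → z'.re = z.re))

/-- A **polygon chart** of a `k`-marked domain: the chart clauses of the route decl bundled —
`w` holomorphic on an open `U ⊇ Ω ∪ {marks}`, bijective `Ω → ℍ`, with `Re (w ∘ boundary)`
strictly increasing near each mark (so the marks have finite real images in boundary order). [folklore] -/
def IsPolygonChart {k : ℕ} (D : MarkedDomain k) (w : ℂ → ℂ) (U : Set ℂ) : Prop :=
  IsOpen U ∧ D.carrier ⊆ U ∧ (∀ i, D.pt i ∈ U) ∧ DifferentiableOn ℂ w U ∧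
    Set.BijOn w D.carrier {z : ℂ | 0 < z.im} ∧
    ∀ i, ∃ ε : ℝ, 0 < ε ∧ StrictMonoOn (fun t : ℝ ↦ (w (D.boundary t)).re)
      (Set.Ioo (D.mark i - ε) (D.mark i + ε))

/-- The chart is also regular at the boundary parameter `t` (the moving point): `boundary t ∈ U`
and `Re (w ∘ boundary)` strictly increasing near `t`. [folklore] -/
def ChartRegularAt {k : ℕ} (D : MarkedDomain k) (w : ℂ → ℂ) (U : Set ℂ) (t : ℝ) : Prop :=
  D.boundary t ∈ U ∧ ∃ ε : ℝ, 0 < ε ∧ StrictMonoOn (fun s : ℝ ↦ (w (D.boundary s)).re)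
    (Set.Ioo (t - ε) (t + ε))

/-- The closure lattice polygon `Ω̄ ∩ δℤ²` as a set of sites (the route's `V_n`, in `Site 2`). [folklore] -/
def latt (D : JordanDomain) (δ : ℝ) : Set (Site 2) := {u | meshPoint δ u ∈ closure D.carrier}

/-- The boundary row of a set of sites: those with a `ℤ²`-neighbour outside. [folklore] -/
def bRow (S : Set (Site 2)) : Set (Site 2) := {u ∈ S | ∃ u', (zdGraph 2).Adj u u' ∧ u' ∉ S}

/-- The **lattice shadow** of a boundary set `B ⊆ ∂Ω` at mesh `δ`: the boundary-row sites of
`Ω̄ ∩ δℤ²` at distance `< δ` from `B`. Along a flat side the shadow of a growing sub-arc gains the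
boundary-row vertices ONE AT A TIME, in order (fixed lead distance `√(δ² - d²)` ahead of the tip). [folklore] -/
def bArc (D : JordanDomain) (δ : ℝ) (B : Set ℂ) : Set (Site 2) :=
  {u ∈ bRow (latt D δ) | Metric.infDist (meshPoint δ u) B < δ}

/-- `P_{1/2}`-probability of an open crossing of `Ω̄ ∩ δℤ²` (induced bond percolation on `ℤ²`)
between the shadows of two boundary sets. [folklore] -/
def crossProb (D : JordanDomain) (δ : ℝ) (A B : Set ℂ) : ℝ :=
  (bondPercolation (zdGraph 2) half).real (openCrossing (latt D δ) (bArc D δ A) (bArc D δ B))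

/-- For a 3-marked domain `(Ω; a, b, c)`: the closed sub-arc of the far arc `(c a)` from `c = pt 2`
to the boundary parameter `t ∈ [mark 2, mark 0 + 1]`. [folklore] -/
def farArcTo (D : MarkedDomain 3) (t : ℝ) : Set ℂ := D.boundary '' Set.Icc (D.mark 2) t

/-- `G_δ(t) = P[(ab)-shadow ↔ shadow of [c, boundary t]]`: non-decreasing in `t`; its single-vertex
increments are the MARK EVENTS `{v ↔ (ab)} ∖ {[c, v) ↔ (ab)}` ("`v` is the `c`-most vertex of the
far arc joined to `(ab)`"), at `t = mark 3` of a conformal rectangle it is the crux's crossing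
probability in the closure discretisation (`hitProb_restrict`). [folklore] -/
def hitProb (D : MarkedDomain 3) (δ t : ℝ) : ℝ :=
  crossProb D.toJordanDomain δ (D.arc 0) (farArcTo D t)

/-- The polygon mark density in the chart `w`: `C · Δ_w^{1/3} · ∏_i |w x - w(pt i)|^{-2/3} · |w'(x)|`
— the half-plane pure product (crux 5 `HalfPlaneMarkDensityLaw`) read in HARMONIC-MEASURE
coordinates `dw = |w'| ds` (the quantized corner charges act on the sink only). [folklore] -/
def markDensityRHS (C : ℝ) (w : ℂ → ℂ) (a b c x : ℂ) : ℝ :=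
  C * (‖w a - w b‖ * ‖w b - w c‖ * ‖w a - w c‖) ^ (1 / 3 : ℝ) *
    (‖w x - w a‖ * ‖w x - w b‖ * ‖w x - w c‖) ^ (-(2 / 3) : ℝ) * ‖deriv w x‖

/-- STUB 4's target — **the LOCAL mark-density law in rectilinear polygons** (percolation only):
ONE constant `C > 0` such that for every bounded rectilinear 3-marked Jordan domain with flat
marks, every polygon chart, every flat far-arc point `x = boundary tx` at which the chart is
regular, every mesh sequence and every pair of target parameters `t_n ≤ t'_n → tx` whose shadows
differ by exactly ONE vertex `v_n`:
`δ_n^{-1} · (G_{δ_n}(t'_n) - G_{δ_n}(t_n)) → C · Δ_w^{1/3} ∏ |w x - w aᵢ|^{-2/3} |w'(x)|`.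
Strictly STRONGER than the crux (a lattice-local law; its window sums are Cardy differences);
the constant is NOT asserted to be `cardyConst/3` — `stub_integration` pins it by total mass. [folklore] -/
def PolygonMarkDensity : Prop :=
  ∃ C : ℝ, 0 < C ∧ ∀ (D : MarkedDomain 3), IsRectilinearJ D.toJordanDomain →
    (∀ i, FlatNear D.toJordanDomain (D.pt i)) →
    ∀ (w : ℂ → ℂ) (U : Set ℂ), IsPolygonChart D w U →
    ∀ (tx : ℝ), D.mark 2 < tx → tx < D.mark 0 + 1 → FlatNear D.toJordanDomain (D.boundary tx) →
      ChartRegularAt D w U tx →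
    ∀ (δ : ℕ → ℝ), (∀ n, 0 < δ n) → Tendsto δ atTop (𝓝 0) →
    ∀ (t t' : ℕ → ℝ) (v : ℕ → Site 2),
      (∀ n, D.mark 2 < t n ∧ t n ≤ t' n ∧ t' n < D.mark 0 + 1) →
      Tendsto t atTop (𝓝 tx) → Tendsto t' atTop (𝓝 tx) →
      (∀ n, v n ∉ bArc D.toJordanDomain (δ n) (farArcTo D (t n)) ∧
        bArc D.toJordanDomain (δ n) (farArcTo D (t' n)) =
          insert (v n) (bArc D.toJordanDomain (δ n) (farArcTo D (t n)))) →
      Tendsto (fun n ↦ (δ n)⁻¹ * (hitProb D (δ n) (t' n) - hitProb D (δ n) (t n))) atTop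
        (𝓝 (markDensityRHS C w (D.pt 0) (D.pt 1) (D.pt 2) (D.boundary tx)))

/-- STUB 5 statement — **RSW tightness in rectilinear polygons** (closure discretisation):
(T-small) the `(ab)`-shadow reaches the shadow of a small boundary ball around any point OFF the
closed arc `(ab)` (corners, reflex corners and the other marks included) with probability `< ε`
for all small meshes (a one-arm bound in annuli around `z`); (T-one) it reaches the shadow of
`[c, boundary t]` with probability `> 1 - ε`, for all small meshes, once the REMAINING gap arc
`boundary [t, mark 0 + 1]` (from the tip back to `a`) lies in a small ball around `a` (a dual arm
from `(bc)` into that ball is the only obstruction; spatial closeness of the tip alone would not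
do — thin necks). [folklore] -/
def PolygonTightness : Prop :=
  (∀ (D : MarkedDomain 3), IsRectilinearJ D.toJordanDomain →
    ∀ z ∈ frontier D.carrier, z ∉ D.arc 0 → ∀ ε : ℝ, 0 < ε → ∃ r : ℝ, 0 < r ∧
      ∀ᶠ δ in 𝓝[>] (0 : ℝ),
        crossProb D.toJordanDomain δ (D.arc 0) (Metric.ball z r ∩ frontier D.carrier) < ε) ∧
  (∀ (D : MarkedDomain 3), IsRectilinearJ D.toJordanDomain →
    ∀ ε : ℝ, 0 < ε → ∃ r : ℝ, 0 < r ∧ ∀ t : ℝ, D.mark 2 < t → t < D.mark 0 + 1 →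
      D.boundary '' Set.Icc t (D.mark 0 + 1) ⊆ Metric.ball (D.pt 0) r →
      ∀ᶠ δ in 𝓝[>] (0 : ℝ), 1 - ε < hitProb D δ t)

/-- The crux's crossing probability in the CLOSURE discretisation: `Ω̄ ∩ δℤ²` with induced edges,
arcs = lattice shadows of `R.arc 0 = (ab)` and `R.arc 2 = (cd)`. [folklore] -/
def closureCrossingProb (R : ConformalRectangle) (δ : ℝ) : ℝ :=
  crossProb R.toJordanDomain δ (R.arc 0) (R.arc 2)

/-- STUB 6's target — Cardy's formula for rectilinear conformal rectangles in the closure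
discretisation. [folklore] -/
def ClosureCardy : Prop :=
  ∀ R : ConformalRectangle, IsRectilinearJ R.toJordanDomain →
    R.HasCrossingLimit (closureCrossingProb R) cardyFunction

/-- STUB 7 statement — **discretisation insensitivity**: for rectilinear `R` the crux's own
crossing probability (`bondDomainCrossingProb`: largest component of the INTERIOR mesh points,
closed-segment mesh edges, nearest-arc discrete arcs with the `≤` tie) and the closure-lattice one
differ by `o(1)` as `δ → 0⁺` (boundary layer of one row; a three-arm / one-column continuity
estimate — the obstruction recorded at Disproof `squareCrossingHalf_conj`). [folklore] -/
def DiscretisationInsensitive : Prop :=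
  ∀ R : ConformalRectangle, IsRectilinearJ R.toJordanDomain →
    Tendsto (fun δ ↦ bondDomainCrossingProb R δ - closureCrossingProb R δ) (𝓝[>] (0 : ℝ)) (𝓝 0)

/-! #### Sorry-free certificates of the percolation bookkeeping -/

/-- The crux's rectilinearity hypothesis is `IsRectilinearJ` (by `rfl`). [folklore] -/
theorem isRectilinearJ_iff (R : ConformalRectangle) :
    IsRectilinearJ R.toJordanDomain ↔
      Theorems.RectilinearCardy.Negative.IsRectilinear R := Iff.rfl

/-- Dropping the fourth mark: `(Ω; a, b, c, d) ↦ (Ω; a, b, c)`. [folklore] -/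
def drop4 (R : ConformalRectangle) : MarkedDomain 3 :=
  R.restrictMarks (Fin.castLEOrderEmb (by decide : 3 ≤ 4))

/-- **The density family telescopes to the crux's crossing** (closure discretisation): at the
parameter of the fourth mark, `G_δ(mark 3)` of `(Ω; a, b, c)` IS `closureCrossingProb R δ`
(`farArcTo (drop4 R) (R.mark 3) = R.arc 2`, `(drop4 R).arc 0 = R.arc 0`). [folklore] -/
theorem hitProb_drop4 (R : ConformalRectangle) (δ : ℝ) :
    hitProb (drop4 R) δ (R.mark 3) = closureCrossingProb R δ := by
  have h0 : (drop4 R).arc 0 = R.arc 0 := by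
    simp only [MarkedDomain.arc, MarkedDomain.nextMark, drop4, MarkedDomain.restrictMarks]
    rfl
  have h2 : farArcTo (drop4 R) (R.mark 3) = R.arc 2 := by
    simp only [farArcTo, MarkedDomain.arc, MarkedDomain.nextMark, drop4, MarkedDomain.restrictMarks]
    rfl
  simp only [hitProb, closureCrossingProb, h0, h2]
  rfl

/-- **Closure Cardy + discretisation insensitivity ⇒ the crux's limit**, for one rectangle. [folklore] -/
theorem hasCrossingLimit_of_closure (R : ConformalRectangle)
    (h₁ : R.HasCrossingLimit (closureCrossingProb R) cardyFunction)
    (h₂ : Tendsto (fun δ ↦ bondDomainCrossingProb R δ - closureCrossingProb R δ)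
      (𝓝[>] (0 : ℝ)) (𝓝 0)) :
    R.HasCrossingLimit (bondDomainCrossingProb R) cardyFunction := by
  intro φ x hφ
  have h := (h₁ φ x hφ).add h₂
  rw [add_zero] at h
  refine h.congr' (Eventually.of_forall fun δ ↦ ?_)
  ring

/-- Shadows are monotone in the boundary set (for a nonempty smaller set). [folklore] -/
theorem bArc_mono (D : JordanDomain) (δ : ℝ) {B B' : Set ℂ} (h : B ⊆ B') (hB : B.Nonempty) :
    bArc D δ B ⊆ bArc D δ B' := fun _ hu ↦
  ⟨hu.1, lt_of_le_of_lt (Metric.infDist_le_infDist_of_subset h hB) hu.2⟩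

/-- Crossing events are monotone in the target set. [folklore] -/
theorem openCrossing_mono_right {V : Type*} (S A : Set V) {B B' : Set V} (h : B ⊆ B') :
    openCrossing S A B ⊆ openCrossing S A B' := by
  rintro ω ⟨x, hx, y, hy, hω⟩
  exact ⟨x, hx, y, h hy, hω⟩

/-- **One-vertex increments are mark events**: `{A ↔ insert v B} = {A ↔ v} ∪ {A ↔ B}`, so the
increment of `hitProb` when the shadow gains `v` is `P[{(ab) ↔ v} ∖ {(ab) ↔ [c, v)}]` — the
`(1,1,1;3̄)` rainbow event of the dictionary (`stub_markDensity`). [folklore] -/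
theorem openCrossing_insert {V : Type*} (S A B : Set V) (v : V) :
    openCrossing S A (insert v B) = openCrossing S A {v} ∪ openCrossing S A B := by
  ext ω
  constructor
  · rintro ⟨x, hx, y, hy, hω⟩
    rcases hy with rfl | hy
    · exact Or.inl ⟨x, hx, _, rfl, hω⟩
    · exact Or.inr ⟨x, hx, y, hy, hω⟩
  · rintro (⟨x, hx, y, hy, hω⟩ | ⟨x, hx, y, hy, hω⟩)
    · exact ⟨x, hx, y, Or.inl hy, hω⟩
    · exact ⟨x, hx, y, Or.inr hy, hω⟩

/-- `t ↦ G_δ(t)` is non-decreasing on `[mark 2, ∞)`. [folklore] -/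
theorem hitProb_mono (D : MarkedDomain 3) (δ : ℝ) {t t' : ℝ} (ht : D.mark 2 ≤ t) (htt' : t ≤ t') :
    hitProb D δ t ≤ hitProb D δ t' := by
  unfold hitProb crossProb
  refine measureReal_mono ?_
  refine openCrossing_mono_right _ _ (bArc_mono _ _ (Set.image_mono (Set.Icc_subset_Icc_right htt')) ?_)
  exact ⟨D.boundary (D.mark 2), Set.mem_image_of_mem _ (Set.left_mem_Icc.2 ht)⟩

/-- `0 ≤ G_δ(t) ≤ 1`. [folklore] -/
theorem hitProb_mem_Icc (D : MarkedDomain 3) (δ t : ℝ) : hitProb D δ t ∈ Set.Icc (0 : ℝ) 1 :=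
  ⟨measureReal_nonneg, measureReal_le_one⟩

/-! ### §3 The registered stubs (the ONLY `sorry`s of this file) and their name-keyed aliases -/

/-- STUB 1 (XL) — renormalised NAIVE Dirichlet law of the positive `Δ = -1/2` six-vertex model for
the `(1,1,1;3̄)` collar in rectilinear polygons (`PolygonNaive1113`). -/
theorem stub_naive : PolygonNaive1113 := by
  sorry

/-- STUB 2 (XL, HARDEST) — the TWIST ANOMALY of the `(1,1,1;3̄)` collar in rectilinear polygons:
source–sink pairs `|ax|^{1/3}|bx|^{1/3}`, `|ab|^{-1/3}`, and the one-body corner potential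
`|w'(x)|^{-1/3}` (`PolygonAnomaly1113`). -/
theorem stub_anomaly : PolygonAnomaly1113 := by
  sorry

/-- STUB 3 (M) — the SPLIT: naive law × anomaly law ⇒ the `(1,1,1;3̄)` Kac law (product of
limits; eventual non-vanishing of the four `Z⁺` from the naive limit / admissibility; the exponent
algebra is `rhs_split`). -/
theorem stub_split : PolygonNaive1113 → PolygonAnomaly1113 → LegLaw1113 := by
  sorry

/-- STUB 4 (M/L) — RAINBOW DICTIONARY + realisation: the `(1,1,1;3̄)` Kac law ⇒ the local polygon
mark density (BKW identity `‖Zins‖/‖Z‖ = P[mark event]`, SPEC §D4 of stmt-14132; admissible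
realisations along the boundary row; `Ω; a,b,c` re-marked with the moving point). -/
theorem stub_markDensity : LegLaw1113 → PolygonMarkDensity := by
  sorry

/-- STUB 5 (M/L) — RSW tightness in rectilinear polygons (`PolygonTightness`). -/
theorem stub_tightness : PolygonTightness := by
  sorry

/-- STUB 6 (L) — DENSITY INTEGRATION: local law + tightness ⇒ Cardy in the closure discretisation
(Riemann sums along the boundary rows in the chart coordinate, corner/initial pieces by (T-small),
constant pinned to `cardyConst/3` by (T-one) and total mass, `PureProductIntegrates`, corner marks
by approximation, Schwarz-reflection charts for polygons). -/
theorem stub_integration : PolygonMarkDensity → PolygonTightness → ClosureCardy := by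
  sorry

/-- STUB 7 (M/L) — DISCRETISATION INSENSITIVITY (`DiscretisationInsensitive`). -/
theorem stub_discretisation : DiscretisationInsensitive := by
  sorry

namespace Sig

/-- Alias of `PolygonNaive1113` keyed by the registered stub name. -/
abbrev stub_naive : Prop := PolygonNaive1113
/-- Alias of `PolygonAnomaly1113` keyed by the registered stub name. -/
abbrev stub_anomaly : Prop := PolygonAnomaly1113
/-- Alias keyed by the registered stub name. -/
abbrev stub_split : Prop := PolygonNaive1113 → PolygonAnomaly1113 → LegLaw1113
/-- Alias keyed by the registered stub name. -/
abbrev stub_markDensity : Prop := LegLaw1113 → PolygonMarkDensity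
/-- Alias of `PolygonTightness` keyed by the registered stub name. -/
abbrev stub_tightness : Prop := PolygonTightness
/-- Alias keyed by the registered stub name. -/
abbrev stub_integration : Prop := PolygonMarkDensity → PolygonTightness → ClosureCardy
/-- Alias of `DiscretisationInsensitive` keyed by the registered stub name. -/
abbrev stub_discretisation : Prop := DiscretisationInsensitive

end Sig

/-! ### §4 The compositions (conclude the crux BY NAME; no `sorry`) -/

/-- The percolation half of the line: the `(1,1,1;3̄)` Kac law and stubs 4–7 give the crux. [folklore] -/
theorem rectilinearCardy_of_legLaw1113 (hK : LegLaw1113) (h₄ : Sig.stub_markDensity)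
    (h₅ : Sig.stub_tightness) (h₆ : Sig.stub_integration) (h₇ : Sig.stub_discretisation) :
    RectilinearCardy := by
  have hC : ClosureCardy := h₆ (h₄ hK) h₅
  intro R hR
  exact hasCrossingLimit_of_closure R (hC R hR) (h₇ R hR)

/-- **`RectilinearCardy` from the seven stubs.** -/
theorem RectilinearCardy_of (h₁ : Sig.stub_naive) (h₂ : Sig.stub_anomaly) (h₃ : Sig.stub_split)
    (h₄ : Sig.stub_markDensity) (h₅ : Sig.stub_tightness) (h₆ : Sig.stub_integration)
    (h₇ : Sig.stub_discretisation) : RectilinearCardy :=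
  rectilinearCardy_of_legLaw1113 (h₃ h₁ h₂) h₄ h₅ h₆ h₇

/-- The crux from the registered (sorried) stubs — the lead's closing theorem. -/
theorem rectilinearCardy_proof : RectilinearCardy :=
  RectilinearCardy_of stub_naive stub_anomaly stub_split stub_markDensity stub_tightness
    stub_integration stub_discretisation

/-- **Second composition — from the route's engine crux directly**: `BoundaryDefectGaussianR`
(stmt-14132, a registered route item) replaces stubs 1–3. [folklore] -/
theorem rectilinearCardy_of_routeLegLaw (h : BoundaryDefectGaussianR) (h₄ : Sig.stub_markDensity)
    (h₅ : Sig.stub_tightness) (h₆ : Sig.stub_integration) (h₇ : Sig.stub_discretisation) :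
    RectilinearCardy :=
  rectilinearCardy_of_legLaw1113 (legLaw1113_of_route h) h₄ h₅ h₆ h₇

end Summit.CriticalPhenomena.CardyFormulaZ2.Cruxes.RectilinearCardy.QuarterChargeCorners

end

#h21_check_skeleton "stmt-CriticalPhenomena-5660" Summit.CriticalPhenomena.CardyFormulaZ2.Theses.CardyBoundaryCoulombGas.RectilinearCardy stub_naive stub_anomaly stub_split stub_markDensity stub_tightness stub_integration stub_discretisation
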